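import Literature.Analysis.FluidPDE.OnsagerBDSVParameters
import Literature.Analysis.FluidPDE.OnsagerBDSVStages
import HarnessLib

/-!
# The BDSV gluing stage: the parameter identities of §4 ((4.6) and its relatives)

Buckmaster–De Lellis–Székelyhidi–Vicol, *Onsager's conjecture for admissible weak solutions*,
CPAM 72 (2019) = arXiv:1701.08678, §4.3–4.4, convert the stability bounds of §3 (powers of
`τ_q = ℓ^{2α}δ_q^{-1/2}λ_q⁻¹` (2.16), `δ_{q+1}`, `ℓ`) into the target bounds (2.18)–(2.22) through a
handful of identities between the parameters, all consequences of the definitions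
`ℓ = δ_{q+1}^{1/2}δ_q^{-1/2}λ_q^{-1-3α/2}` (2.10)′, (2.16) and the upper half `ℓ ≤ λ_q⁻¹` of (2.11)
(valid for all `a, b ≥ 1`, `β, α ≥ 0`, `Literature` `BDSV.mollScale_le_freq_inv`). This file proves
them once, for all `a ≥ 1`, `b ≥ 1`, `β ≥ 0`, `α ≥ 0`:

* `BDSV.glueScale_mul_sqrt_amp_mul_freq` : `τ_q δ_q^{1/2} λ_q = ℓ^{2α}` ((2.16));
* `BDSV.sqrt_amp_succ_eq` : `δ_{q+1}^{1/2} = ℓ δ_q^{1/2} λ_q^{1+3α/2}` ((2.10)′ solved for `δ_{q+1}`);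
* `BDSV.sqrt_amp_succ_mul_glueScale_le` : **(4.6)** `δ_{q+1}^{1/2} τ_q ≤ ℓ`
  (`= ℓ · ℓ^{2α}λ_q^{3α/2} ≤ ℓ λ_q^{-α/2} ≤ ℓ`);
* `BDSV.glueScale_mul_amp_succ_mul_rpow_le` : `τ_q δ_{q+1} ℓ^{-N-2+α} ≤ δ_q^{1/2} λ_q ℓ^{-N}`
  (proof of Prop. 4.2: "`δ_{q+1}τ_qℓ^{-N-2+α} = δ_q^{1/2}λ_q(ℓλ_q)^{3α}ℓ^{-N} ≤ δ_q^{1/2}λ_qℓ^{-N}`");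
* `BDSV.glueScale_inv_eq` : `τ_q⁻¹ = δ_q^{1/2} λ_q ℓ^{-2α}`, whence
  `τ_q⁻¹ δ_{q+1} ℓ^{-N+α} = δ_{q+1} δ_q^{1/2} λ_q ℓ^{-N-α}` (last line of the proof of Prop. 4.3).

## References

* T. Buckmaster, C. De Lellis, L. Székelyhidi Jr., V. Vicol, *Onsager's conjecture for admissible
  weak solutions*, Comm. Pure Appl. Math. 72 (2019) 229–274 = arXiv:1701.08678, §2.4 (2.10)–(2.11),
  §2.5 (2.16), §4.3 (4.6) and the proof of Prop. 4.2, §4.4 (proof of Prop. 4.3).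
-/

noncomputable section

open Set

namespace Literature.Analysis.FluidPDE

namespace BDSV

variable {β α a b : ℝ}

/-- (2.16) solved: `τ_q δ_q^{1/2} λ_q = ℓ^{2α}` (`a ≥ 1`). [cite: BuckmasterEtAl2018, §2.5 (2.16)] -/
theorem glueScale_mul_sqrt_amp_mul_freq (ha : 1 ≤ a) (q : ℕ) :
    glueScale β α a b q * (Real.sqrt (amp β a b q) * freq a b q) = mollScale β α a b q ^ (2 * α) := by
  have hA : 0 < Real.sqrt (amp β a b q) * freq a b q :=
    mul_pos (Real.sqrt_pos.2 (amp_pos ha q)) (freq_pos ha q)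
  unfold glueScale
  rw [div_mul_cancel₀ _ hA.ne']

/-- (2.10)′ solved for `δ_{q+1}`: `δ_{q+1}^{1/2} = ℓ δ_q^{1/2} λ_q^{1+3α/2}` (`a ≥ 1`). [cite: BuckmasterEtAl2018, §2.4 (2.10)] -/
theorem sqrt_amp_succ_eq (ha : 1 ≤ a) (q : ℕ) :
    Real.sqrt (amp β a b (q + 1)) = mollScale β α a b q * (Real.sqrt (amp β a b q) * freq a b q ^ (1 + 3 * α / 2)) := by
  have hB : 0 < Real.sqrt (amp β a b q) * freq a b q ^ (1 + 3 * α / 2) :=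
    mul_pos (Real.sqrt_pos.2 (amp_pos ha q)) (Real.rpow_pos_of_pos (freq_pos ha q) _)
  unfold mollScale
  rw [div_mul_cancel₀ _ hB.ne']

/-- `ℓ^{2α} λ_q^{3α/2} ≤ 1` for `a, b ≥ 1`, `β, α ≥ 0` (from `ℓ ≤ λ_q⁻¹`: `ℓ^{2α}λ_q^{3α/2} ≤ λ_q^{-α/2} ≤ 1`;
the middle step of (4.6)). [cite: BuckmasterEtAl2018, §4.3 (4.6)] -/
theorem mollScale_rpow_two_mul_mul_freq_rpow_le_one (ha : 1 ≤ a) (hb : 1 ≤ b) (hβ : 0 ≤ β) (hα : 0 ≤ α) (q : ℕ) :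
    mollScale β α a b q ^ (2 * α) * freq a b q ^ (3 * α / 2) ≤ 1 := by
  have hf := freq_pos (b := b) ha q
  have hf1 := one_le_freq (b := b) ha q
  have hℓ := mollScale_pos (β := β) (α := α) (b := b) ha q
  have h1 : mollScale β α a b q ^ (2 * α) ≤ freq a b q ^ (-(2 * α)) := by
    calc mollScale β α a b q ^ (2 * α) ≤ ((freq a b q)⁻¹) ^ (2 * α) :=
          Real.rpow_le_rpow hℓ.le (mollScale_le_freq_inv ha hb hβ hα q) (by linarith)
      _ = freq a b q ^ (-(2 * α)) := by rw [Real.inv_rpow hf.le, Real.rpow_neg hf.le]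
  calc mollScale β α a b q ^ (2 * α) * freq a b q ^ (3 * α / 2)
      ≤ freq a b q ^ (-(2 * α)) * freq a b q ^ (3 * α / 2) :=
        mul_le_mul_of_nonneg_right h1 (Real.rpow_nonneg hf.le _)
    _ = freq a b q ^ (-(α / 2)) := by rw [← Real.rpow_add hf]; congr 1; ring
    _ ≤ 1 := Real.rpow_le_one_of_one_le_of_nonpos hf1 (by linarith)

/-- **(4.6)**: `δ_{q+1}^{1/2} τ_q ≤ ℓ`, i.e. `δ_{q+1}^{1/2}τ_qℓ⁻¹ = ℓ^{2α}λ_q^{3α/2} ≤ λ_q^{-α/2} ≤ 1`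
(`a, b ≥ 1`, `β, α ≥ 0`). [cite: BuckmasterEtAl2018, §4.3 (4.6)] -/
theorem sqrt_amp_succ_mul_glueScale_le (ha : 1 ≤ a) (hb : 1 ≤ b) (hβ : 0 ≤ β) (hα : 0 ≤ α) (q : ℕ) :
    Real.sqrt (amp β a b (q + 1)) * glueScale β α a b q ≤ mollScale β α a b q := by
  have hf := freq_pos (b := b) ha q
  have hδ := Real.sqrt_pos.2 (amp_pos (β := β) (b := b) ha q)
  have hℓ := mollScale_pos (β := β) (α := α) (b := b) ha q
  have hA : 0 < Real.sqrt (amp β a b q) * freq a b q := mul_pos hδ hf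
  -- `δ_{q+1}^{1/2} τ = ℓ · (ℓ^{2α} λ^{3α/2})`
  have e : Real.sqrt (amp β a b (q + 1)) * glueScale β α a b q =
      mollScale β α a b q * (mollScale β α a b q ^ (2 * α) * freq a b q ^ (3 * α / 2)) := by
    rw [sqrt_amp_succ_eq ha q]
    unfold glueScale
    rw [show (1 + 3 * α / 2 : ℝ) = 1 + (3 * α / 2) from rfl, Real.rpow_add hf, Real.rpow_one]
    field_simp
  rw [e]
  exact mul_le_of_le_one_right hℓ.le (mollScale_rpow_two_mul_mul_freq_rpow_le_one ha hb hβ hα q)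

/-- `(λ_q ℓ)^{3α} ≤ 1`, i.e. `λ_q^{3α} ℓ^{3α} ≤ 1`, for `a, b ≥ 1`, `β, α ≥ 0`. [cite: BuckmasterEtAl2018, Prop. 4.2 (proof)] -/
theorem freq_rpow_mul_mollScale_rpow_le_one (ha : 1 ≤ a) (hb : 1 ≤ b) (hβ : 0 ≤ β) (hα : 0 ≤ α) (q : ℕ) :
    freq a b q ^ (3 * α) * mollScale β α a b q ^ (3 * α) ≤ 1 := by
  have hf := freq_pos (b := b) ha q
  have hℓ := mollScale_pos (β := β) (α := α) (b := b) ha q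
  rw [← Real.mul_rpow hf.le hℓ.le]
  refine Real.rpow_le_one (mul_nonneg hf.le hℓ.le) ?_ (by linarith)
  calc freq a b q * mollScale β α a b q ≤ freq a b q * (freq a b q)⁻¹ :=
        mul_le_mul_of_nonneg_left (mollScale_le_freq_inv ha hb hβ hα q) hf.le
    _ = 1 := mul_inv_cancel₀ hf.ne'

/-- **The conversion of the proof of Prop. 4.2**: `τ_q δ_{q+1} ℓ^{-N-2+α} ≤ δ_q^{1/2} λ_q ℓ^{-N}`
(`= δ_q^{1/2}λ_q(ℓλ_q)^{3α}ℓ^{-N}`), for `a, b ≥ 1`, `β, α ≥ 0` and real `N`. [cite: BuckmasterEtAl2018, Prop. 4.2 (proof)] -/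
theorem glueScale_mul_amp_succ_mul_rpow_le (ha : 1 ≤ a) (hb : 1 ≤ b) (hβ : 0 ≤ β) (hα : 0 ≤ α) (q : ℕ) (N : ℝ) :
    glueScale β α a b q * amp β a b (q + 1) * mollScale β α a b q ^ (-N - 2 + α) ≤
      Real.sqrt (amp β a b q) * freq a b q * mollScale β α a b q ^ (-N) := by
  have hf := freq_pos (b := b) ha q
  have hδ := Real.sqrt_pos.2 (amp_pos (β := β) (b := b) ha q)
  have hδ1 := amp_pos (β := β) (b := b) ha (q + 1)
  have hℓ := mollScale_pos (β := β) (α := α) (b := b) ha q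
  -- `δ_{q+1} = ℓ² δ_q λ^{2+3α}`
  have e1 : amp β a b (q + 1) = (mollScale β α a b q * (Real.sqrt (amp β a b q) * freq a b q ^ (1 + 3 * α / 2))) ^ 2 := by
    rw [← sqrt_amp_succ_eq ha q, Real.sq_sqrt hδ1.le]
  have hsq : Real.sqrt (amp β a b q) ^ 2 = amp β a b q := Real.sq_sqrt (amp_pos ha q).le
  have hℓ2 : (mollScale β α a b q) ^ 2 = mollScale β α a b q ^ (2 : ℝ) := by
    rw [← Real.rpow_natCast]; norm_num
  have hf2 : (freq a b q ^ (1 + 3 * α / 2)) ^ 2 = freq a b q ^ (2 + 3 * α) := by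
    rw [← Real.rpow_natCast, ← Real.rpow_mul hf.le]; congr 1; push_cast; ring
  have hL : ∀ x y : ℝ, mollScale β α a b q ^ x * mollScale β α a b q ^ y = mollScale β α a b q ^ (x + y) :=
    fun x y => (Real.rpow_add hℓ x y).symm
  have hF : ∀ x y : ℝ, freq a b q ^ x * freq a b q ^ y = freq a b q ^ (x + y) :=
    fun x y => (Real.rpow_add hf x y).symm
  -- the left-hand side as a monomial
  have e2 : glueScale β α a b q * amp β a b (q + 1) * mollScale β α a b q ^ (-N - 2 + α) =
      Real.sqrt (amp β a b q) * freq a b q ^ (1 + 3 * α) * mollScale β α a b q ^ (3 * α - N) := by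
    unfold glueScale
    rw [e1, mul_pow, mul_pow, hℓ2, hsq, hf2, div_eq_mul_inv, mul_inv]
    have g1 : amp β a b q * (Real.sqrt (amp β a b q))⁻¹ = Real.sqrt (amp β a b q) := by
      rw [eq_comm, eq_mul_inv_iff_mul_eq₀ hδ.ne', ← pow_two, hsq]
    have g2 : freq a b q ^ (2 + 3 * α) * (freq a b q)⁻¹ = freq a b q ^ (1 + 3 * α) := by
      rw [← Real.rpow_neg_one, hF]; congr 1; ring
    have g3 : mollScale β α a b q ^ (2 * α) * mollScale β α a b q ^ (2 : ℝ) * mollScale β α a b q ^ (-N - 2 + α) =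
        mollScale β α a b q ^ (3 * α - N) := by
      rw [hL, hL]; congr 1; ring
    calc mollScale β α a b q ^ (2 * α) * ((Real.sqrt (amp β a b q))⁻¹ * (freq a b q)⁻¹) *
          (mollScale β α a b q ^ (2 : ℝ) * (amp β a b q * freq a b q ^ (2 + 3 * α))) * mollScale β α a b q ^ (-N - 2 + α)
        = (amp β a b q * (Real.sqrt (amp β a b q))⁻¹) * (freq a b q ^ (2 + 3 * α) * (freq a b q)⁻¹) *
            (mollScale β α a b q ^ (2 * α) * mollScale β α a b q ^ (2 : ℝ) * mollScale β α a b q ^ (-N - 2 + α)) := by ring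
      _ = _ := by rw [g1, g2, g3]
  -- the right-hand side (times the small factor) as the same monomial
  have e3 : Real.sqrt (amp β a b q) * freq a b q * mollScale β α a b q ^ (-N) *
      (freq a b q ^ (3 * α) * mollScale β α a b q ^ (3 * α)) =
      Real.sqrt (amp β a b q) * freq a b q ^ (1 + 3 * α) * mollScale β α a b q ^ (3 * α - N) := by
    have g4 : freq a b q * freq a b q ^ (3 * α) = freq a b q ^ (1 + 3 * α) := by
      rw [show freq a b q * freq a b q ^ (3 * α) = freq a b q ^ (1 : ℝ) * freq a b q ^ (3 * α) by rw [Real.rpow_one], hF]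
    have g5 : mollScale β α a b q ^ (-N) * mollScale β α a b q ^ (3 * α) = mollScale β α a b q ^ (3 * α - N) := by
      rw [hL]; congr 1; ring
    calc Real.sqrt (amp β a b q) * freq a b q * mollScale β α a b q ^ (-N) * (freq a b q ^ (3 * α) * mollScale β α a b q ^ (3 * α))
        = Real.sqrt (amp β a b q) * (freq a b q * freq a b q ^ (3 * α)) * (mollScale β α a b q ^ (-N) * mollScale β α a b q ^ (3 * α)) := by ring
      _ = _ := by rw [g4, g5]
  rw [e2, ← e3]
  exact mul_le_of_le_one_right (by positivity) (freq_rpow_mul_mollScale_rpow_le_one ha hb hβ hα q)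

/-- `τ_q⁻¹ = δ_q^{1/2} λ_q ℓ^{-2α}` (`a ≥ 1`). [cite: BuckmasterEtAl2018, §2.5 (2.16)] -/
theorem glueScale_inv_eq (ha : 1 ≤ a) (q : ℕ) :
    (glueScale β α a b q)⁻¹ = Real.sqrt (amp β a b q) * freq a b q * mollScale β α a b q ^ (-(2 * α)) := by
  have hℓ := mollScale_pos (β := β) (α := α) (b := b) ha q
  unfold glueScale
  rw [inv_div, Real.rpow_neg hℓ.le, div_eq_mul_inv]

end BDSV

end Literature.Analysis.FluidPDE
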